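import Mathlib
import Summits.KontsevichZagierPeriods.KontsevichZagierPeriods.Theorems.SoloInformedDualRiemannKit
import Literature.NumberTheory.Transcendental.KZHomotopyMoves
import Literature.NumberTheory.Transcendental.KZSemialgebraicComplex
import Literature.NumberTheory.Transcendental.KZProductIdeal
import Literature.NumberTheory.Transcendental.KZLogCalculusProofs
import Literature.NumberTheory.Transcendental.KZCalculusProofs
import Literature.NumberTheory.Transcendental.KZIntervalPeriodProofs
import Literature.NumberTheory.Transcendental.SemialgebraicMapsProofs
import HarnessLib
import HarnessLib.Audit

/-!
# The dual Riemann relations are theorems of the calculus, II: non-adjacent ovals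
(solo-informed, s36 — THEOREM XXVII-K)

Let `f ∈ ℚ[x]` and let `(a,b)`, `(c,d)` be two rational intervals with DISJOINT closures on
which `f` has no zero, with `f(a) = f(b) = f(c) = f(d) = 0`, and such that `|f|^{-1/2}` is
integrable on both (e.g. two non-adjacent real ovals `I_k × I_l`, `|k − l| ≥ 2`, of a real
hyperelliptic curve `y² = f(x)`).  Write `Y(x) = √|f(x)|` and
`T(x₁,x₂) = [(f(x₁) − f(x₂))/(x₁ − x₂) − ½(f'(x₁) + f'(x₂))]/(x₁ − x₂) ∈ ℚ[x₁,x₂]`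
(the reduced symmetric kernel whose coefficient matrix is `−2 S⁻¹`, `S` the intersection matrix
of the forms `x^j dx/y` — the CASIMIR IDENTITY of the paper, §6terdecies).  Then the class of the
integral representation `[(a,b) × (c,d), T/(Y(x₁)Y(x₂))]` lies in `KZ.relations`
(`soloInformed_dualRiemann_nonadjacent`): the DUAL Riemann bilinear relation
`Σ (S⁻¹)_{jj'} P_k(x^j) P_l(x^{j'}) = 0` for non-adjacent ovals is a theorem of the four rules.

The proof is four moves.  With `A(x₁,x₂) = f(x₂)/((x₁−x₂)Y₁Y₂)` one has, on the open
rectangle, `T/(Y₁Y₂) = ∂₁[A(x₂,x₁)] − ∂₂[A(x₁,x₂)]` (a real, sign-free form of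
`dΛ₀ = T dx₁dx₂/(y₁y₂)`, `Λ₀ = (f(x₂)dx₁ − f(x₁)dx₂)/((x₁−x₂)y₁y₂)`), and `A(x₁,·)` is
continuous on the CLOSED fibre `[c,d]` with boundary values `0` (because `f(c) = f(d) = 0`):
rule (3) along `x₂` kills `[rectangle, ∂₂A]` (`soloInformedDR_kill`), the same after the
coordinate swap (rule (2), a permutation) kills `[rectangle, ∂₁A(x₂,x₁)]`, and integrand
additivity (rule (1b)) concludes.  The adjacent case `l = k ± 1` (value `±π`) is NOT of this form
(the split integrands are not absolutely integrable at the common corner) and is treated at paper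
level.

References: M. Kontsevich, D. Zagier, *Periods* (2001), §1.2; V. M. Buchstaber, V. Z. Enolskii,
D. V. Leykin, *Kleinian functions, hyperelliptic Jacobians and applications* (1997) (the
classical form of the kernel); this work (solo-informed s36).
-/

noncomputable section

open MeasureTheory Set Filter Topology Polynomial
open scoped Classical

open Literature.NumberTheory.Transcendental Literature.NumberTheory.Transcendental.KZ
open Literature.ModelTheory.ExponentialFields

namespace Summit.KontsevichZagierPeriods.KontsevichZagierPeriods.Theorems

/-! ### The fibrewise kill -/

/-- Membership in the band `(α,β) × [γ,δ] ⊆ ℝ²` (fibre coordinate last). [folklore] -/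
theorem soloInformedDR_mem_band {α β γ δ : ℚ} {z : Fin 2 → ℝ} :
    z ∈ KZlog.band {v : Fin 1 → ℝ | (α:ℝ) < v 0 ∧ v 0 < (β:ℝ)} (fun _ => (γ:ℝ)) (fun _ => (δ:ℝ)) ↔
      ((α:ℝ) < z 0 ∧ z 0 < (β:ℝ)) ∧ (γ:ℝ) ≤ z 1 ∧ z 1 ≤ (δ:ℝ) := by
  rw [KZlog.mem_band]
  simp only [mem_setOf_eq, Fin.init, Fin.castSucc_zero, show (Fin.last 1) = 1 from rfl]

/-- **The kill** (THEOREM XXVII-K, engine).  Let `(α,β)` (base) and `[γ,δ]` (fibre) be rational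
intervals with disjoint closures, `f(γ) = f(δ) = 0`, `f ≠ 0` on `(α,β)` and on `(γ,δ)`, and
`|f|^{-1/2}` integrable on both open intervals.  Then for every coordinate permutation `e` of
`ℝ²` there is an integral representation on `{w | w(e 0) ∈ (α,β), w(e 1) ∈ (γ,δ)}` with
integrand `(∂A)(w ∘ e)` whose class lies in `KZ.relations`: one Newton–Leibniz move along the
fibre (`A(p,·)` is continuous on `[γ,δ]` with `A(p,γ) = A(p,δ) = 0`), opening the fibres
(rule 1), and a permutation of coordinates (rule 2). [cite: KontsevichZagier2001, §1.2]
[this work] -/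
theorem soloInformedDR_kill (f : ℚ[X]) (α β γ δ : ℚ) (hγδ : γ ≤ δ) (hdisj : β < γ ∨ δ < α)
    (hγ : aeval (γ:ℝ) f = 0) (hδ : aeval (δ:ℝ) f = 0)
    (hne₀ : ∀ x ∈ Ioo (α:ℝ) β, aeval x f ≠ 0) (hne₁ : ∀ x ∈ Ioo (γ:ℝ) δ, aeval x f ≠ 0)
    (hi₀ : IntegrableOn (fun x => (√|aeval x f|)⁻¹) (Ioo (α:ℝ) β))
    (hi₁ : IntegrableOn (fun x => (√|aeval x f|)⁻¹) (Ioo (γ:ℝ) δ)) (e : Equiv.Perm (Fin 2)) :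
    ∃ T : IntegralRep 2,
      T.domain = {w | ((α:ℝ) < w (e 0) ∧ w (e 0) < (β:ℝ)) ∧ (γ:ℝ) < w (e 1) ∧ w (e 1) < (δ:ℝ)} ∧
      (T.integrand = fun w => soloInformedDRDer f (fun i => w (e i))) ∧ of T ∈ relations := by
  -- the base, the band, the separation
  set D : Set (Fin 1 → ℝ) := {v | (α:ℝ) < v 0 ∧ v 0 < (β:ℝ)} with hDdef
  have hD : IsSemialgebraic ℚ D := soloInformedDR_sa_base α β
  have hDm : MeasurableSet D := IsSemialgebraic.measurableSet_holds hD
  have hcγ : IsSemialgebraicFunOn ℚ D (fun _ => ((γ:ℚ):ℝ)) := isSemialgebraicFunOn_ratCast hD γ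
  have hcδ : IsSemialgebraicFunOn ℚ D (fun _ => ((δ:ℚ):ℝ)) := isSemialgebraicFunOn_ratCast hD δ
  set band : Set (Fin 2 → ℝ) := KZlog.band D (fun _ => (γ:ℝ)) (fun _ => (δ:ℝ)) with hband_def
  have hband : IsSemialgebraic ℚ band := KZlog.isSemialgebraic_band hcγ hcδ
  have hband_m : MeasurableSet band := IsSemialgebraic.measurableSet_holds hband
  have hmem : ∀ z : Fin 2 → ℝ, z ∈ band ↔ ((α:ℝ) < z 0 ∧ z 0 < (β:ℝ)) ∧ (γ:ℝ) ≤ z 1 ∧ z 1 ≤ (δ:ℝ) :=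
    fun z => soloInformedDR_mem_band
  set ε : ℝ := max ((γ:ℝ) - β) ((α:ℝ) - δ) with hεdef
  have hε : 0 < ε := by
    rcases hdisj with h | h
    · exact lt_max_of_lt_left (by exact_mod_cast sub_pos.2 h)
    · exact lt_max_of_lt_right (by exact_mod_cast sub_pos.2 h)
  have hsep : ∀ p t : ℝ, (α:ℝ) < p ∧ p < β → (γ:ℝ) ≤ t ∧ t ≤ δ → ε ≤ |p - t| := by
    intro p t hp ht
    refine max_le ?_ ?_
    · calc (γ:ℝ) - β ≤ t - p := by linarith [hp.2, ht.1]
        _ ≤ |p - t| := by rw [abs_sub_comm]; exact le_abs_self _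
    · calc (α:ℝ) - δ ≤ p - t := by linarith [hp.1, ht.2]
        _ ≤ |p - t| := le_abs_self _
  have hsep' : ∀ p t : ℝ, (α:ℝ) < p ∧ p < β → (γ:ℝ) ≤ t ∧ t ≤ δ → p ≠ t := by
    intro p t hp ht hpt
    have := hsep p t hp ht
    rw [hpt, sub_self, abs_zero] at this
    exact absurd this (not_le.2 hε)
  -- bounds for `f`, `f'` on the closed fibre interval
  obtain ⟨C, hC⟩ := (isCompact_Icc : IsCompact (Icc (γ:ℝ) δ)).exists_bound_of_continuousOn
    (Polynomial.continuous_aeval f).continuousOn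
  obtain ⟨C', hC'⟩ := (isCompact_Icc : IsCompact (Icc (γ:ℝ) δ)).exists_bound_of_continuousOn
    (Polynomial.continuous_aeval (derivative f)).continuousOn
  set Mφ : ℝ := max C 0
  set Mφ' : ℝ := max C' 0
  have hbφ : ∀ t ∈ Icc (γ:ℝ) δ, |aeval t f| ≤ Mφ := fun t ht =>
    (Real.norm_eq_abs _ ▸ hC t ht).trans (le_max_left _ _)
  have hbφ' : ∀ t ∈ Icc (γ:ℝ) δ, |aeval t (derivative f)| ≤ Mφ' := fun t ht =>
    (Real.norm_eq_abs _ ▸ hC' t ht).trans (le_max_left _ _)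
  -- semialgebraicity of the primitive and of the integrand on the band
  have hsa := soloInformedDR_sa_prim_der hband f fun w hw => by
    rw [hmem] at hw
    exact ⟨hsep' _ _ hw.1 hw.2, hne₀ _ hw.1⟩
  -- fibrewise continuity and derivative
  have hcont : ∀ v ∈ D, ContinuousOn (fun t : ℝ => soloInformedDRPrim f (Fin.snoc v t))
      (Icc (γ:ℝ) δ) := fun v hv =>
    soloInformedDR_prim_continuousOn f v (fun t ht => hsep' _ _ hv ht) (hne₀ _ hv)
  have hder : ∀ v ∈ D, ∀ t ∈ Ioo (γ:ℝ) δ, HasDerivAt (fun s : ℝ => soloInformedDRPrim f (Fin.snoc v s))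
      (soloInformedDRDer f (Fin.snoc v t)) t := fun v hv t ht =>
    soloInformedDR_prim_hasDerivAt f v (hsep' _ _ hv ⟨ht.1.le, ht.2.le⟩) (hne₀ _ hv) (hne₁ t ht)
  -- integrability of the integrand on the band, by domination
  set u₀ : ℝ → ℝ := (Ioo (α:ℝ) β).indicator fun x => (√|aeval x f|)⁻¹
  set u₁ : ℝ → ℝ := (Ioo (γ:ℝ) δ).indicator fun x => (√|aeval x f|)⁻¹
  have hu₀ : Integrable u₀ := hi₀.integrable_indicator measurableSet_Ioo
  have hu₁ : Integrable u₁ := hi₁.integrable_indicator measurableSet_Ioo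
  have hint : IntegrableOn (soloInformedDRDer f) band := by
    refine soloInformedDR_integrableOn_of_le hband_m
      (aestronglyMeasurable_of_isSemialgebraicFunOn hsa.2 hband_m) hu₀ hu₁
      (Mφ' / (2 * ε) + Mφ / ε ^ 2) fun w hw => ?_
    rw [hmem] at hw
    have hw0 : w 0 ∈ Ioo (α:ℝ) β := hw.1
    have hu₀w : u₀ (w 0) = (√|aeval (w 0) f|)⁻¹ := indicator_of_mem hw0 _
    by_cases hw1 : w 1 ∈ Ioo (γ:ℝ) δ
    · have hu₁w : u₁ (w 1) = (√|aeval (w 1) f|)⁻¹ := indicator_of_mem hw1 _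
      rw [hu₀w, hu₁w]
      exact soloInformedDR_der_bound f hε (le_max_right _ _) (le_max_right _ _) w
        (hsep _ _ hw.1 hw.2) (hbφ _ hw.2) (hbφ' _ hw.2) (hne₀ _ hw.1) (hne₁ _ hw1)
    · -- an end fibre point: `f(w 1) = 0`, both sides vanish
      have hw1' : w 1 = γ ∨ w 1 = δ := by
        rcases hw.2.1.lt_or_eq with h1 | h1
        · rcases hw.2.2.lt_or_eq with h2 | h2
          · exact absurd ⟨h1, h2⟩ hw1
          · exact Or.inr h2
        · exact Or.inl h1.symm
      have hf1 : aeval (w 1) f = 0 := by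
        rcases hw1' with h | h <;> rw [h] <;> assumption
      have hu₁w : u₁ (w 1) = 0 := indicator_of_notMem hw1 _
      have hA0 : soloInformedDRDer f w = 0 := by
        simp [soloInformedDRDer, soloInformedDRY, hf1]
      rw [hA0, hu₁w]; simp
  -- the boundary function vanishes
  have h0 : ∀ v ∈ D, soloInformedDRPrim f (Fin.snoc v (δ:ℝ)) -
      soloInformedDRPrim f (Fin.snoc v (γ:ℝ)) = 0 := by
    intro v _
    have e1 : ∀ t : ℝ, (Fin.snoc v t : Fin 2 → ℝ) 1 = t := fun _ => rfl
    simp [soloInformedDRPrim, e1, hγ, hδ]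
  have hds : IsSemialgebraicFunOn ℚ D (fun v => soloInformedDRPrim f (Fin.snoc v ((fun _ => (δ:ℝ)) v)) -
      soloInformedDRPrim f (Fin.snoc v ((fun _ => (γ:ℝ)) v))) :=
    (isSemialgebraicFunOn_const_of_isAlgebraic hD isAlgebraic_zero).congr fun v hv => (h0 v hv).symm
  have hdi : IntegrableOn (fun v => soloInformedDRPrim f (Fin.snoc v ((fun _ => (δ:ℝ)) v)) -
      soloInformedDRPrim f (Fin.snoc v ((fun _ => (γ:ℝ)) v))) D :=
    integrableOn_zero.congr_fun (fun v hv => (h0 v hv).symm) hDm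
  -- rule (3)
  obtain ⟨rb, rd, hrbd, hrbi, hrdd, hrdi, hrel⟩ := exists_band_newtonLeibniz hD
    (fun _ => (γ:ℝ)) (fun _ => (δ:ℝ)) hcγ hcδ (fun _ _ => by exact_mod_cast hγδ)
    (soloInformedDRPrim f) (soloInformedDRDer f) hsa.1 hsa.2 hcont hder hint hds hdi
  have hrd : of rd ∈ relations := by
    refine of_mem_relations_of_eqOn_zero rd fun v hv => ?_
    rw [hrdd] at hv
    simp only [hrdi, Pi.zero_apply]
    exact h0 v hv
  have hrb : of rb ∈ relations := by
    have := relations.add_mem hrel hrd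
    simpa using this
  -- rule (1): open the fibres
  obtain ⟨r', hr'd, hr'i, hrel'⟩ := of_sub_of_restrict_openBand_mem_relations hcγ hcδ rb hrbd
  have hr' : of r' ∈ relations := by
    have := relations.sub_mem hrb hrel'
    simpa using this
  -- rule (2): permute the coordinates
  have hre : of (r'.reindex e) ∈ relations := by
    have := relations.sub_mem hr' (of_sub_of_reindex_mem_relations r' e)
    simpa using this
  refine ⟨r'.reindex e, ?_, ?_, hre⟩
  · rw [IntegralRep.reindex_domain, hr'd]
    ext w
    exact Iff.rfl
  · rw [IntegralRep.reindex_integrand, hr'i, hrbi]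

/-! ### THEOREM XXVII-K: the non-adjacent dual Riemann relation -/

/-- **THEOREM XXVII-K (the dual Riemann bilinear relation for non-adjacent ovals is a theorem
of the KZ calculus).**  Let `f ∈ ℚ[x]`, `a < b`, `c < d` rational with `[a,b] ∩ [c,d] = ∅`,
`f(a) = f(b) = f(c) = f(d) = 0`, `f ≠ 0` on `(a,b) ∪ (c,d)`, and `|f|^{-1/2}` integrable on
`(a,b)` and on `(c,d)` (so that the half-period representations `[(a,b), x^j/√|f|]`,
`[(c,d), x^j/√|f|]` exist).  Then there is an integral representation on the open rectangle
`(a,b) × (c,d)` with integrand the dual Riemann kernel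
`Θ = [(f(x₁)−f(x₂))/(x₁−x₂) − ½(f'(x₁)+f'(x₂))]/((x₁−x₂)√|f(x₁)|√|f(x₂)|)` whose class lies in
`KZ.relations`; in particular `∫∫ Θ = 0`, i.e. `Σ_{j,j'} (S⁻¹)_{jj'} P_{(a,b)}(x^j) P_{(c,d)}(x^{j'}) = 0`
holds inside the period algebra `P = KZ.FormalRep ⧸ KZ.relations` generated by the four rules.
Four moves: `Θ = (∂A)∘swap − ∂A` (integrand additivity) and two kills (`soloInformedDR_kill`).
[cite: KontsevichZagier2001, §1.2] [this work] -/
theorem soloInformed_dualRiemann_nonadjacent (f : ℚ[X]) (a b c d : ℚ) (hab : a < b) (hcd : c < d)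
    (hdisj : b < c ∨ d < a)
    (ha : aeval (a:ℝ) f = 0) (hb : aeval (b:ℝ) f = 0) (hc : aeval (c:ℝ) f = 0)
    (hd : aeval (d:ℝ) f = 0)
    (hne₁ : ∀ x ∈ Ioo (a:ℝ) b, aeval x f ≠ 0) (hne₂ : ∀ x ∈ Ioo (c:ℝ) d, aeval x f ≠ 0)
    (hi₁ : IntegrableOn (fun x => (√|aeval x f|)⁻¹) (Ioo (a:ℝ) b))
    (hi₂ : IntegrableOn (fun x => (√|aeval x f|)⁻¹) (Ioo (c:ℝ) d)) :
    ∃ R : IntegralRep 2,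
      R.domain = {w | ((a:ℝ) < w 0 ∧ w 0 < (b:ℝ)) ∧ (c:ℝ) < w 1 ∧ w 1 < (d:ℝ)} ∧
      R.integrand = soloInformedDRTheta f ∧ of R ∈ relations := by
  -- kill of `∂A` on `(a,b) × (c,d)` (fibre `x₂`)
  obtain ⟨RA, hRAd, hRAi, hRA⟩ := soloInformedDR_kill f a b c d hcd.le hdisj hc hd hne₁ hne₂ hi₁ hi₂
    (Equiv.refl _)
  -- kill of `(∂A)∘swap` (fibre `x₁`)
  obtain ⟨RB, hRBd, hRBi, hRB⟩ := soloInformedDR_kill f c d a b hab.le hdisj.symm ha hb hne₂ hne₁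
    hi₂ hi₁ (Equiv.swap 0 1)
  set box : Set (Fin 2 → ℝ) := {w | ((a:ℝ) < w 0 ∧ w 0 < (b:ℝ)) ∧ (c:ℝ) < w 1 ∧ w 1 < (d:ℝ)}
    with hbox
  have hRAd' : RA.domain = box := by
    rw [hRAd]; ext w; simp only [Equiv.refl_apply, mem_setOf_eq, hbox]
  have hRBd' : RB.domain = box := by
    rw [hRBd]; ext w
    simp only [Equiv.swap_apply_left, Equiv.swap_apply_right, mem_setOf_eq, hbox]
    tauto
  have hbox_sa : IsSemialgebraic ℚ box := hRAd' ▸ RA.isSemialgebraic_domain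
  have hbox_m : MeasurableSet box := IsSemialgebraic.measurableSet_holds hbox_sa
  have hRAi' : ∀ w, RA.integrand w = soloInformedDRDer f w := fun w => by
    simp [hRAi]
  have hRBi' : ∀ w, RB.integrand w = soloInformedDRDer f (fun i => w (Equiv.swap 0 1 i)) :=
    fun w => by rw [hRBi]
  -- the pointwise identity on the box
  have hid : ∀ w ∈ box, RB.integrand w - RA.integrand w = soloInformedDRTheta f w := by
    intro w hw
    rw [hRAi', hRBi']
    have hne : w 0 ≠ w 1 := by
      intro h
      rcases hdisj with h1 | h1
      · have : (b:ℝ) < c := by exact_mod_cast h1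
        linarith [hw.1.2, hw.2.1]
      · have : (d:ℝ) < a := by exact_mod_cast h1
        linarith [hw.1.1, hw.2.2]
    exact soloInformedDR_theta_eq f w hne (hne₁ _ hw.1) (hne₂ _ hw.2)
  have hsaA : IsSemialgebraicFunOn ℚ box RA.integrand := hRAd' ▸ RA.isSemialgebraicFunOn_integrand
  have hsaB : IsSemialgebraicFunOn ℚ box RB.integrand := hRBd' ▸ RB.isSemialgebraicFunOn_integrand
  have hsaΘ : IsSemialgebraicFunOn ℚ box (soloInformedDRTheta f) :=
    (IsSemialgebraicFunOn.sub_holds hsaB hsaA).congr fun w hw => by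
      simpa only [Pi.sub_apply] using hid w hw
  have hiA : IntegrableOn RA.integrand box := hRAd' ▸ RA.integrableOn
  have hiB : IntegrableOn RB.integrand box := hRBd' ▸ RB.integrableOn
  have hiΘ : IntegrableOn (soloInformedDRTheta f) box :=
    (hiB.sub hiA).congr_fun (fun w hw => hid w hw) hbox_m
  let R : IntegralRep 2 := ⟨box, soloInformedDRTheta f, hbox_sa, hsaΘ, hiΘ⟩
  -- integrand additivity: `[box, (∂A)∘swap] − [box, Θ] − [box, ∂A]` is a relation
  have hadd : of RB - of R - of RA ∈ relations :=
    integrandAddRel_subset_relations ⟨2, RB, R, RA, hRBd'.symm ▸ rfl, hRAd'.trans hRBd'.symm,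
      fun w hw => by
        rw [hRBd'] at hw
        show RB.integrand w = soloInformedDRTheta f w + RA.integrand w
        rw [← hid w hw]
        ring, rfl⟩
  have hR : of R ∈ relations := by
    have := relations.sub_mem (relations.sub_mem hRB hRA) hadd
    convert this using 1
    abel
  exact ⟨R, rfl, rfl, hR⟩

end Summit.KontsevichZagierPeriods.KontsevichZagierPeriods.Theorems

end
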